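import Literature.AlgebraicGeometry.Motives.KunnethCechBaseChange
import Literature.AlgebraicGeometry.Morphisms.CechH1PullbackComp
import Mathlib.RingTheory.Flat.Basic
import Mathlib.LinearAlgebra.TensorProduct.RightExactness
import HarnessLib

/-!
# Künneth for `Ȟ¹` on `U ×_k 𝒲`: cocycles as tensors (flatness over the field `k`)

Let `X`, `Y` be `k`-schemes, `U ⊆ X` a quasi-compact quasi-separated open and `𝒲 = (W_b)` a finite
family of affine opens of the quasi-separated `Y`. By `Motives/KunnethCechBaseChange`, the Čech
complex of `𝒪_{X ×_k Y}` on `U ×_k 𝒲 = (U ×_k W_b)_b` is `Γ(U) ⊗_k Č•(𝒲, 𝒪_Y)` (degrees `≤ 2`);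
since every `k`-module is flat, `Γ(U) ⊗_k −` is exact, which gives the Künneth formula
`Ȟ¹(U ×_k 𝒲, 𝒪) ≅ Γ(U, 𝒪_X) ⊗_k Ȟ¹(𝒲, 𝒪_Y)` (Görtz–Wedhorn II, Cor. 22.110 for the qcqs schemes
`U`, `Y` in degree `1`, with `H¹(U, 𝒪) = 0`-free bookkeeping avoided: we only record the three
consequences consumed by the product-covering computation of `Motives/KunnethH1ProductCover`):

* `exists_tensorCocycle` / `tensorCocycle_unique` — every `1`-cocycle `z` on `U ×_k 𝒲` is
  `kunnethC1 (T')` for a unique `T' ∈ Γ(U) ⊗_k Ž¹(𝒲)`;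
* `lTensor_mk_rTensor_res_eq` — the class `(id ⊗ [·]) T' ∈ Γ(U) ⊗_k Ȟ¹(𝒲)` is compatible with
  restriction to `U' ⊆ U` whenever the cocycles are (up to a coboundary);
* `sub_refine_comap_snd_mem_cechB1` — if `(id ⊗ [·]) T' = 1 ⊗ [β]` then `z` is cohomologous to
  the pullback `pr_Y^* β` on `U ×_k 𝒲`.

Tools: `Module.Flat.lTensor_exact`, `Module.Flat.lTensor_preserves_injective_linearMap`,
`lTensor_exact` (right exactness) from Mathlib; the exact sequences `Ž¹ ↪ Č¹ → Č²` and
`Č⁰ → Ž¹ → Ȟ¹ → 0` of `Morphisms/CechH1` (`exact_cechZ1_subtype_cechD1`, `exact_cechD0Z_mk`, with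
`d⁰` corestricted to the cocycles, `(cechD0 g W).codRestrict (cechZ1 g W) _`).

## References

* U. Görtz, T. Wedhorn, *Algebraic Geometry II: Cohomology of Schemes*, Springer Spektrum (2023),
  doi:10.1007/978-3-658-43031-3: Cor. 22.110, p. 399 (read via the held copy). [GortzWedhorn2023]
* The Stacks Project, Tag 0BEC (Künneth formula). [StacksProject]
-/

universe u v

open CategoryTheory CategoryTheory.Limits AlgebraicGeometry MonoidalCategory TensorProduct
open CartesianMonoidalCategory
open Literature.AlgebraicGeometry.Morphisms

noncomputable section

namespace Literature.AlgebraicGeometry.Motives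

variable {k : Type u} [Field k]

/-! ### The exact sequences of the Čech complex of `𝒲` -/

section CechExact

variable {Z : Scheme.{u}} (g : Z ⟶ Spec (.of k)) {B : Type v} (W : B → Z.Opens)

/-- `Ž¹ ↪ Č¹ → Č²` is exact. [folklore] -/
theorem exact_cechZ1_subtype_cechD1 :
    Function.Exact (cechZ1 g W).subtype (cechD1 g W) :=
  LinearMap.exact_subtype_ker_map (cechD1 g W)

/-- `Č⁰ → Ž¹ → Ȟ¹` is exact. [folklore] -/
theorem exact_cechD0Z_mk :
    Function.Exact ((cechD0 g W).codRestrict (cechZ1 g W) fun b => cechB1_le_cechZ1 g W ⟨b, rfl⟩)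
      (CechH1.mk g W) := by
  rw [LinearMap.exact_iff, CechH1.mk, Submodule.ker_mkQ, LinearMap.range_codRestrict]
  rfl

/-- `Ž¹ ↪ Č¹` after `d⁰ : Č⁰ → Ž¹` is `d⁰`. [folklore] -/
theorem subtype_comp_cechD0Z :
    (cechZ1 g W).subtype ∘ₗ ((cechD0 g W).codRestrict (cechZ1 g W) fun b =>
      cechB1_le_cechZ1 g W ⟨b, rfl⟩) = cechD0 g W :=
  LinearMap.subtype_comp_codRestrict _ _ _

end CechExact

variable (X Y : SchemeOver k) {U U' : X.left.Opens} {B : Type v} (W : B → Y.left.Opens)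

/-! ### Cocycles on `U ×_k 𝒲` as tensors -/

/-- **Every `1`-cocycle on `U ×_k 𝒲` is a tensor cocycle**: `z = kunnethC1 ((id ⊗ ι) T')` for some
`T' ∈ Γ(U, 𝒪_X) ⊗_k Ž¹(𝒲, 𝒪_Y)` (`kunnethC1` bijective, `kunnethC2` injective and compatible with
`d¹`, and exactness of `Γ(U) ⊗_k (Ž¹ ↪ Č¹ → Č²)` by flatness over the field `k`).
[cite: GortzWedhorn2023, Cor. 22.110 (p. 399)] -/
theorem exists_tensorCocycle [Finite B] [QuasiSeparatedSpace ↥Y.left]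
    (hU : IsCompact (U : Set X.left)) (hU' : IsQuasiSeparated (U : Set X.left))
    (hW : ∀ b, IsAffineOpen (W b)) {z : CechC1 (X ⊗ Y).hom (prodFamilyRight X Y U W)}
    (hz : z ∈ cechZ1 (X ⊗ Y).hom (prodFamilyRight X Y U W)) :
    ∃ T' : Sections X.hom U ⊗[k] ↥(cechZ1 Y.hom W),
      kunnethC1 X Y U W (LinearMap.lTensor _ (cechZ1 Y.hom W).subtype T') = z := by
  obtain ⟨T, rfl⟩ := (kunnethC1_bijective X Y U W hU hU' hW).2 z
  have hT : LinearMap.lTensor (Sections X.hom U) (cechD1 Y.hom W) T = 0 := by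
    apply kunnethC2_injective X Y U W hU hU' hW
    rw [kunnethC2_lTensor_cechD1, map_zero]
    exact (mem_cechZ1_iff _ _ _).mp hz
  obtain ⟨T', hT'⟩ := (Module.Flat.lTensor_exact (Sections X.hom U)
    (exact_cechZ1_subtype_cechD1 Y.hom W) T).mp hT
  exact ⟨T', by rw [hT']⟩

/-- ... and `T'` is unique. [folklore] -/
theorem tensorCocycle_unique [Finite B] [QuasiSeparatedSpace ↥Y.left]
    (hU : IsCompact (U : Set X.left)) (hU' : IsQuasiSeparated (U : Set X.left))
    (hW : ∀ b, IsAffineOpen (W b)) {T₁ T₂ : Sections X.hom U ⊗[k] ↥(cechZ1 Y.hom W)}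
    (h : kunnethC1 X Y U W (LinearMap.lTensor _ (cechZ1 Y.hom W).subtype T₁) =
      kunnethC1 X Y U W (LinearMap.lTensor _ (cechZ1 Y.hom W).subtype T₂)) : T₁ = T₂ :=
  Module.Flat.lTensor_preserves_injective_linearMap (M := Sections X.hom U) _
    (Submodule.injective_subtype _) ((kunnethC1_bijective X Y U W hU hU' hW).1 h)

/-- `(res ⊗ id)` and `(id ⊗ ψ)` commute. [folklore] -/
theorem rTensor_lTensor_comm {R R' N N' : Type*} [AddCommGroup R] [Module k R]
    [AddCommGroup R'] [Module k R'] [AddCommGroup N] [Module k N] [AddCommGroup N'] [Module k N']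
    (φ : R →ₗ[k] R') (ψ : N →ₗ[k] N') (T : R ⊗[k] N) :
    LinearMap.rTensor N' φ (LinearMap.lTensor R ψ T) =
      LinearMap.lTensor R' ψ (LinearMap.rTensor N φ T) := by
  rw [← LinearMap.comp_apply, ← LinearMap.comp_apply, LinearMap.rTensor_comp_lTensor,
    LinearMap.lTensor_comp_rTensor]

/-- **Compatibility of the tensor classes with restriction.** For `U' ⊆ U` (both qcqs), cocycles
`z` on `U ×_k 𝒲` and `z'` on `U' ×_k 𝒲` whose difference on `U' ×_k 𝒲` is a coboundary, and their
tensor cocycles `T'`, `T''`: the classes `(id ⊗ [·]) T' |_{U'} = (id ⊗ [·]) T''` in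
`Γ(U', 𝒪_X) ⊗_k Ȟ¹(𝒲, 𝒪_Y)`. [cite: GortzWedhorn2023, Cor. 22.110 (p. 399)] -/
theorem lTensor_mk_rTensor_res_eq [Finite B] [QuasiSeparatedSpace ↥Y.left] (hle : U' ≤ U)
    (hU₂ : IsCompact (U' : Set X.left)) (hU₂' : IsQuasiSeparated (U' : Set X.left))
    (hW : ∀ b, IsAffineOpen (W b))
    {z : CechC1 (X ⊗ Y).hom (prodFamilyRight X Y U W)}
    {z' : CechC1 (X ⊗ Y).hom (prodFamilyRight X Y U' W)}
    (hzz' : cechRefineC1 (X ⊗ Y).hom (prodFamilyRight X Y U W) (prodFamilyRight X Y U' W) id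
        (fun _ => prodOpen_mono X Y hle le_rfl) z - z' ∈ cechB1 (X ⊗ Y).hom (prodFamilyRight X Y U' W))
    {T' : Sections X.hom U ⊗[k] ↥(cechZ1 Y.hom W)}
    (hT' : kunnethC1 X Y U W (LinearMap.lTensor _ (cechZ1 Y.hom W).subtype T') = z)
    {T'' : Sections X.hom U' ⊗[k] ↥(cechZ1 Y.hom W)}
    (hT'' : kunnethC1 X Y U' W (LinearMap.lTensor _ (cechZ1 Y.hom W).subtype T'') = z') :
    LinearMap.lTensor _ (CechH1.mk Y.hom W)
        (LinearMap.rTensor _ (Sections.res X.hom hle).toLinearMap T') =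
      LinearMap.lTensor _ (CechH1.mk Y.hom W) T'' := by
  -- the coboundary, as a tensor `0`-cochain `et` over `U'`
  obtain ⟨e, he⟩ := (mem_cechB1_iff _ _ _).mp hzz'
  obtain ⟨et, rfl⟩ := (kunnethPi_bijective X Y U' W (prodFamilyRight X Y U' W)
    (prodFamilyRight_le_fst X Y U' W) (prodFamilyRight_le_snd X Y U' W) hU₂ hU₂'
    (fun b => (hW b).isCompact) (fun b => (hW b).isQuasiSeparated) (fun b => le_rfl)).2 e
  -- `(res ⊗ id) T' - T'' = (id ⊗ d⁰_Z) et`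
  have key : LinearMap.rTensor _ (Sections.res X.hom hle).toLinearMap T' - T'' =
      LinearMap.lTensor _ (((cechD0 Y.hom W).codRestrict (cechZ1 Y.hom W) fun b => cechB1_le_cechZ1 Y.hom W ⟨b, rfl⟩)) et := by
    apply Module.Flat.lTensor_preserves_injective_linearMap (M := Sections X.hom U') _
      (Submodule.injective_subtype (cechZ1 Y.hom W))
    apply (kunnethC1_bijective X Y U' W hU₂ hU₂' hW).1
    rw [map_sub, map_sub, ← rTensor_lTensor_comm, kunnethC1_rTensor_res, hT', hT'',
      ← LinearMap.lTensor_comp_apply, subtype_comp_cechD0Z, kunnethC1_lTensor_cechD0]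
    exact he.symm
  have h2 := congrArg (LinearMap.lTensor (Sections X.hom U') (CechH1.mk Y.hom W)) key
  rw [map_sub, ← LinearMap.lTensor_comp_apply, (exact_cechD0Z_mk Y.hom W).linearMap_comp_eq_zero,
    LinearMap.lTensor_zero, LinearMap.zero_apply, sub_eq_zero] at h2
  exact h2

/-- **From tensor classes to coboundaries.** If the tensor cocycle `T'` of `z` has class
`(id ⊗ [·]) T' = 1 ⊗ [β]` for a cocycle `β` on `𝒲`, then `z` is cohomologous on `U ×_k 𝒲` to the
pullback `pr_Y^* β` (refined from `pr_Y⁻¹𝒲`): right exactness of `Γ(U) ⊗_k (Č⁰ → Ž¹ → Ȟ¹ → 0)`.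
[cite: GortzWedhorn2023, Cor. 22.110 (p. 399)] -/
theorem sub_refine_comap_snd_mem_cechB1
    {z : CechC1 (X ⊗ Y).hom (prodFamilyRight X Y U W)}
    {T' : Sections X.hom U ⊗[k] ↥(cechZ1 Y.hom W)}
    (hT' : kunnethC1 X Y U W (LinearMap.lTensor _ (cechZ1 Y.hom W).subtype T') = z)
    {β : ↥(cechZ1 Y.hom W)}
    (hβ : LinearMap.lTensor _ (CechH1.mk Y.hom W) T' = (1 : Sections X.hom U) ⊗ₜ CechH1.mk Y.hom W β) :
    z - cechRefineC1 (X ⊗ Y).hom (preimageFamily (snd X Y).left W) (prodFamilyRight X Y U W) id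
        (prodFamilyRight_le_snd X Y U W)
        (cechComapC1 Y.hom (X ⊗ Y).hom (snd X Y).left (snd_left_comp_hom X Y) W β) ∈
      cechB1 (X ⊗ Y).hom (prodFamilyRight X Y U W) := by
  have h1 : LinearMap.lTensor _ (CechH1.mk Y.hom W) (T' - 1 ⊗ₜ β) = 0 := by
    rw [map_sub, hβ, LinearMap.lTensor_tmul, sub_self]
  obtain ⟨et, het⟩ := (lTensor_exact (Sections X.hom U) (exact_cechD0Z_mk Y.hom W)
    (CechH1.mk_surjective Y.hom W) _).mp h1
  -- apply `kunnethC1 ∘ (id ⊗ ι)`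
  have h2 : kunnethC1 X Y U W (LinearMap.lTensor _ (cechZ1 Y.hom W).subtype
      (LinearMap.lTensor _ (((cechD0 Y.hom W).codRestrict (cechZ1 Y.hom W) fun b => cechB1_le_cechZ1 Y.hom W ⟨b, rfl⟩)) et)) =
      kunnethC1 X Y U W (LinearMap.lTensor _ (cechZ1 Y.hom W).subtype (T' - 1 ⊗ₜ β)) := by
    rw [het]
  rw [← LinearMap.lTensor_comp_apply, subtype_comp_cechD0Z, kunnethC1_lTensor_cechD0, map_sub,
    map_sub, hT', LinearMap.lTensor_tmul, Submodule.subtype_apply, kunnethC1_one_tmul] at h2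
  rw [mem_cechB1_iff]
  exact ⟨_, h2⟩

end Literature.AlgebraicGeometry.Motives

end
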